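import Mathlib
import HarnessLib
import Literature.Analysis.FluidPDE.VectorCalculus
import Literature.Analysis.FluidPDE.SelfSimilar

/-!
# ARM B, lane E-exact — DEFINITIONS: the steady backward Leray VORTICITY residual and the forced-Tsai
  modulus statement `ForcedTsaiModulusLE M δ` (ns-wall-extremal PREREG-WALL-1 A1 §B2, AMEND §B2(a)(b);
  exp-lead decision «E-exact GO» 2026-08-28T16:10:33Z)

DEFINITIONS ONLY (reviewed), in the tree's vocabulary (`Literature.Analysis.FluidPDE`: `IsLerayProfile`,
`convect`, `VectorCalculus.IsDivFree`, `curl`, Mathlib `Δ`/`fderiv`):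

* `lerayMomentumResidual U y = −ΔU(y) + ½U(y) + ½DU(y)[y] + (U·∇)U(y)` — the left side of Leray's
  profile system `IsLerayProfile 1 (1/2) U P` WITHOUT the pressure gradient (viscosity `ν = 1`, rate
  `a = ½`, i.e. `u(x,t) = U(x/√(−t))/√(−t)`; PV 2026 (1.12) steady);
* `lerayVorticityResidual U = curl (lerayMomentumResidual U)` — pressure-free («gradient-free»)
  residual `g` of AMEND §B2(a)(b) (for an exact profile `g = −curl ∇P = 0`);
* `lerayLevel U = ‖curl U‖_{L²(B₁₀)}` (the «level» of AMEND §B2(a): enstrophy^{1/2} on `ρ ≤ 10`);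
* `lerayResidualNorm U = ‖(1+ρ)^{5/2} g‖_{L²(ℝ³)}` (the weighted-`L²` residual currency);
* `ForcedTsaiModulusLE M δ` — «there is an explicit smooth divergence-free field `U` with level
  `≥ M` whose weighted vorticity residual is (integrable and) `≤ δ`», i.e. the forced-Tsai modulus
  `δ*(M′) := inf{residual : level = M′}` satisfies `δ*(M′) ≤ δ` for some `M′ ≥ M`.

MEANING (fixed by the exp-lead for RESULTS-WALL-1): a certified row of this statement is an UPPER
bound on `δ*` — «near-profiles with residual this small EXIST» — never a lower bound, never an
exclusion, never a profile (Tsai / Nečas–Růžička–Šverák forbid non-trivial exact steady profiles in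
`L³`).  Certificate rows (lane E-exact: polynomial × Gaussian vector potentials, exact Gaussian moments)
live in the sibling module `…ForcedTsaiCert`.  Nothing here bears on Navier–Stokes regularity; crux
`ScarEnvelopeTypeI` (stmt-23843) and wall H3 are OPEN.
-/

noncomputable section

set_option linter.dupNamespace false

namespace Summit.NavierStokesRegularity.NavierStokesRegularity.Cruxes.ScarEnvelopeTypeI.ForcedTsai

open MeasureTheory Set Metric
open scoped ContDiff Laplacian InnerProductSpace RealInnerProductSpace
open Literature.Analysis.FluidPDE

/-- `ℝ³` as a Euclidean space. -/
abbrev E3 : Type := EuclideanSpace ℝ (Fin 3)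

/-- **Steady backward Leray momentum residual, pressure dropped** (`ν = 1`, rate `½`):
`−ΔU(y) + ½U(y) + ½DU(y)[y] + (U·∇)U(y)` — the left side of `IsLerayProfile 1 (1/2) U P` without
`∇P`. -/
def lerayMomentumResidual (U : E3 → E3) (y : E3) : E3 :=
  -((Δ U) y) + (1 / 2 : ℝ) • U y + (1 / 2 : ℝ) • fderiv ℝ U y y + convect U U y

/-- **Vorticity residual** `g = curl(−ΔU + ½U + ½y·∇U + U·∇U)` (pressure-free currency of
AMEND §B2(a)(b)). -/
def lerayVorticityResidual (U : E3 → E3) (y : E3) : E3 :=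
  curl (lerayMomentumResidual U) y

/-- For an exact Leray profile the momentum residual is `−∇P`. -/
theorem lerayMomentumResidual_eq_neg_gradient {U : E3 → E3} {P : E3 → ℝ}
    (h : IsLerayProfile 1 (1 / 2) U P) (y : E3) :
    lerayMomentumResidual U y = -(gradient P y) := by
  have := h.profile_eq y
  rw [one_smul] at this
  rw [lerayMomentumResidual, eq_neg_iff_add_eq_zero, this]

/-- The **level** of a profile candidate: `‖curl U‖_{L²(B₁₀)}` (enstrophy^{1/2} on the ball of
radius `10`; AMEND §B2(a)). -/
def lerayLevel (U : E3 → E3) : ℝ :=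
  Real.sqrt (∫ y in ball (0 : E3) 10, ‖curl U y‖ ^ 2)

/-- The weighted-`L²` **residual currency** `‖(1+|y|)^{5/2} g‖_{L²(ℝ³)}` of AMEND §B2(a)(b). -/
def lerayResidualNorm (U : E3 → E3) : ℝ :=
  Real.sqrt (∫ y, (1 + ‖y‖) ^ 5 * ‖lerayVorticityResidual U y‖ ^ 2)

/-- **Forced-Tsai modulus bound** `ForcedTsaiModulusLE M δ`: there is an explicit smooth
divergence-free field `U : ℝ³ → ℝ³` with level `‖curl U‖_{L²(B₁₀)} ≥ M` whose weighted vorticity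
residual `(1+|y|)^5 |g|²` is integrable with `‖(1+|y|)^{5/2} g‖_{L²} ≤ δ` — an UPPER bound
`δ*(M′) ≤ δ` for some `M′ ≥ M` on the forced-Tsai modulus; never an exclusion. -/
def ForcedTsaiModulusLE (M δ : ℝ) : Prop :=
  ∃ U : E3 → E3, ContDiff ℝ ∞ U ∧ VectorCalculus.IsDivFree U ∧ M ≤ lerayLevel U ∧
    Integrable (fun y => (1 + ‖y‖) ^ 5 * ‖lerayVorticityResidual U y‖ ^ 2) ∧ lerayResidualNorm U ≤ δ

/-- Monotonicity: a witness at `(M, δ)` is a witness at every `M' ≤ M`, `δ ≤ δ'`. -/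
theorem ForcedTsaiModulusLE.mono {M δ M' δ' : ℝ} (h : ForcedTsaiModulusLE M δ) (hM : M' ≤ M)
    (hδ : δ ≤ δ') : ForcedTsaiModulusLE M' δ' := by
  obtain ⟨U, hU, hdiv, hlev, hint, hres⟩ := h
  exact ⟨U, hU, hdiv, hM.trans hlev, hint, hres.trans hδ⟩

end Summit.NavierStokesRegularity.NavierStokesRegularity.Cruxes.ScarEnvelopeTypeI.ForcedTsai

end
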